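import Summits.AtomisticToContinuum.HydrodynamicLimit.Theorems.EnergyCurrentTails.Negative.CubicTailExpMoment

/-!
# `EnergyCurrentTails` (stmt-AtomisticToContinuum-9235), negative knowledge 3/3: no pathwise maximum principle — collisions focus energy, and binary collision trees do so without bound

Load-bearing analysis of the crux `OneFlightGossipEngine.EnergyCurrentTails` by the standing
disprover (`Cruxes/EnergyCurrentTails/Disproof.lean`, refuter-cdisprove-stmt-AtomisticToContinuum-9235-0).

* `reflectVel_focus`: one elastic collision with impact direction `e₀` maps the incoming pair
  `(-a e₀, a e₁)` to `(0, a e₁ - a e₀)`, transferring ALL the energy to one sphere (speed `a ↦ √2 a`);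
  `cubicTail_not_nonincreasing`: with `a = 1`, `M = 6/5` the pair's cubic tail jumps from `0` to
  `2√2`, so the natural pathwise strengthening `CubicTailNonincreasing` (a maximum principle for the
  crux functional along trajectories) is FALSE.
* `reflectVel_perp`: the iterable form — for `v ⊥ w` the impact direction `v` gives `(v, w) ↦ (0, w + v)`.
* `focusing_tree`: for every `k` and target velocity `V`, `2^k` velocities of speed `|V|/2^{k/2}` are
  carried by pair collisions (`Reach`: repeatedly replace a pair by its `reflectVel` image under some
  impact direction; `exists_perp_split`) to ONE sphere with velocity `V` and `2^k - 1` spheres at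
  rest.  Kinematically the energy-focusing scenario exists for every focusing factor; only the
  Liouville weight of such trees under the evolved law can make the crux true.

The crux itself is NOT refuted (see the Disproof workfile).
-/

noncomputable section

open MeasureTheory Filter Set Topology
open scoped ENNReal

namespace Summit.AtomisticToContinuum.HydrodynamicLimit.Theorems

namespace EnergyCurrentTailsNegative

open Literature.MathematicalPhysics.KineticTheory Literature.Analysis.FluidPDE

/-- The unit vector `e_k` of `ℝ³`. -/
def e (k : Fin 3) : V3 := EuclideanSpace.single k 1

/-- The unit vectors have norm one. -/
@[simp] theorem norm_e (k : Fin 3) : ‖e k‖ = 1 := by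
  simp [e]

/-! ### No pathwise maximum principle: one elastic collision doubles a sphere's kinetic energy -/

/-- **Complete energy transfer in one collision.** Impact direction `e₀`, incoming velocities
`v = -a e₀`, `w = a e₁`: after the collision `v' = 0` and `w' = a e₁ - a e₀`, `|w'|² = 2a²`. -/
theorem reflectVel_focus (a : ℝ) :
    reflectVel (e 0) (-(a • e 0), a • e 1) = ((0 : V3), a • e 1 - a • e 0) := by
  have h00 : @inner ℝ V3 _ (e 0) (e 0) = 1 := by
    rw [real_inner_self_eq_norm_sq, norm_e, one_pow]
  have h10 : @inner ℝ V3 _ (e 1) (e 0) = 0 := by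
    simp [e, EuclideanSpace.inner_single_left]
  have hc : @inner ℝ V3 _ (-(a • e 0) - a • e 1) (e 0) / ‖e 0‖ ^ 2 = -a := by
    rw [norm_e, one_pow, div_one, inner_sub_left, inner_neg_left, inner_smul_left,
      inner_smul_left, h00, h10]
    simp
  unfold reflectVel
  simp only [hc, Prod.mk.injEq]
  constructor
  · simp [neg_smul]
  · rw [neg_smul, ← sub_eq_add_neg]

/-- `|a e₁ - a e₀|² = 2a²`. -/
theorem norm_sq_focus (a : ℝ) : ‖a • e 1 - a • e 0‖ ^ 2 = 2 * a ^ 2 := by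
  rw [EuclideanSpace.norm_sq_eq]
  simp [e, Fin.sum_univ_three]
  ring


/-- **General focusing step** (iterable): for perpendicular incoming velocities `v ⊥ w`, the
collision with impact direction `v` itself stops the first sphere and gives the second ALL the
energy: `(v, w) ↦ (0, w + v)`, `|w + v|² = |v|² + |w|²`.  Since `w + v` can again be split as a sum
of two perpendicular vectors of equal length, binary collision trees focus the energy of `2^k`
spheres of speed `a` onto one sphere of speed `2^{k/2} a` (kinematics only; positions, scheduling
and the Liouville weight of such trees are the real issue). -/
theorem reflectVel_perp {v w : V3} (hv : v ≠ 0) (h : @inner ℝ V3 _ v w = 0) :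
    reflectVel v (v, w) = ((0 : V3), w + v) := by
  have hvv : @inner ℝ V3 _ v v = ‖v‖ ^ 2 := real_inner_self_eq_norm_sq v
  have hn : ‖v‖ ^ 2 ≠ 0 := pow_ne_zero 2 (norm_ne_zero_iff.2 hv)
  have hc : @inner ℝ V3 _ (v - w) v / ‖v‖ ^ 2 = 1 := by
    rw [inner_sub_left, real_inner_comm v w, h, sub_zero, hvv, div_self hn]
  unfold reflectVel
  simp only [hc, one_smul, sub_self]

/-- Pythagoras for the focusing step. -/
theorem norm_sq_add_perp {v w : V3} (h : @inner ℝ V3 _ v w = 0) :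
    ‖w + v‖ ^ 2 = ‖w‖ ^ 2 + ‖v‖ ^ 2 := by
  rw [norm_add_sq_real, real_inner_comm v w, h]
  ring


/-! ### §5b Kinematic focusing trees: `2^k` spheres of speed `a` ↦ one sphere of speed `2^{k/2} a` -/

/-- The focusing step for perpendicular incoming velocities, junk case `v = 0` included. -/
theorem reflectVel_perp' {v w : V3} (h : @inner ℝ V3 _ v w = 0) :
    reflectVel v (v, w) = ((0 : V3), w + v) := by
  by_cases hv : v = 0
  · subst hv; simp [reflectVel]
  · exact reflectVel_perp hv h

/-- Collision-reachability of velocity multisets: repeatedly replace a pair `(v, w)` by its elastic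
image under SOME impact direction (kinematics only — positions and schedules are not modelled). -/
inductive Reach : Multiset V3 → Multiset V3 → Prop
  | refl (s : Multiset V3) : Reach s s
  | collide (n v w : V3) (s : Multiset V3) :
      Reach (v ::ₘ w ::ₘ s) ((reflectVel n (v, w)).1 ::ₘ (reflectVel n (v, w)).2 ::ₘ s)
  | trans {s t u : Multiset V3} : Reach s t → Reach t u → Reach s u

/-- Reachability is stable under adding spectator velocities (right). -/
theorem Reach.add_right {s t : Multiset V3} (h : Reach s t) (u : Multiset V3) :
    Reach (s + u) (t + u) := by
  induction h with
  | refl s => exact Reach.refl _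
  | collide n v w s =>
      have h' := Reach.collide n v w (s + u)
      simpa only [Multiset.cons_add] using h'
  | trans _ _ ih1 ih2 => exact ih1.trans ih2

/-- Reachability is stable under adding spectator velocities (left). -/
theorem Reach.add_left {s t : Multiset V3} (h : Reach s t) (u : Multiset V3) :
    Reach (u + s) (u + t) := by
  simpa only [add_comm] using h.add_right u

/-- In `ℝ³` every vector has a unit vector orthogonal to it. -/
theorem exists_unit_orthogonal (V : V3) : ∃ p : V3, ‖p‖ = 1 ∧ @inner ℝ V3 _ V p = 0 := by
  by_cases hV : V = 0
  · exact ⟨e 0, norm_e 0, by simp [hV]⟩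
  · haveI : Fact (Module.finrank ℝ V3 = 2 + 1) :=
      ⟨by rw [finrank_euclideanSpace, Fintype.card_fin]⟩
    have hfin : Module.finrank ℝ (ℝ ∙ V)ᗮ = 2 := Submodule.finrank_orthogonal_span_singleton hV
    have hpos : 0 < Module.finrank ℝ (ℝ ∙ V)ᗮ := by rw [hfin]; norm_num
    obtain ⟨x, hx⟩ := (Module.finrank_pos_iff_exists_ne_zero).1 hpos
    have hx0 : (x : V3) ≠ 0 := fun h => hx (Subtype.ext h)
    have hxV : @inner ℝ V3 _ V x = 0 :=
      (Submodule.mem_orthogonal_singleton_iff_inner_right).1 x.2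
    refine ⟨‖(x : V3)‖⁻¹ • (x : V3), ?_, ?_⟩
    · rw [norm_smul, norm_inv, norm_norm, inv_mul_cancel₀ (norm_ne_zero_iff.2 hx0)]
    · rw [inner_smul_right, hxV, mul_zero]

/-- Every vector is the sum of two PERPENDICULAR vectors of equal length `|V|/√2`. -/
theorem exists_perp_split (V : V3) : ∃ c₁ c₂ : V3, V = c₁ + c₂ ∧ @inner ℝ V3 _ c₁ c₂ = 0 ∧
    ‖c₁‖ = ‖V‖ / Real.sqrt 2 ∧ ‖c₂‖ = ‖V‖ / Real.sqrt 2 := by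
  obtain ⟨p, hp1, hVp⟩ := exists_unit_orthogonal V
  have hpp : @inner ℝ V3 _ p p = 1 := by rw [real_inner_self_eq_norm_sq, hp1, one_pow]
  have hVV : @inner ℝ V3 _ V V = ‖V‖ ^ 2 := real_inner_self_eq_norm_sq V
  have hpV : @inner ℝ V3 _ p V = 0 := by rw [real_inner_comm, hVp]
  have h2 : Real.sqrt 2 ≠ 0 := by positivity
  have hs2 : Real.sqrt 2 ^ 2 = 2 := Real.sq_sqrt (by norm_num)
  -- norms of (V ± |V| p)/2
  have hn : ∀ σs : ℝ, σs ^ 2 = 1 →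
      ‖(2 : ℝ)⁻¹ • (V + (σs * ‖V‖) • p)‖ = ‖V‖ / Real.sqrt 2 := by
    intro σs hσs
    have hσn : ‖σs * ‖V‖‖ ^ 2 = ‖V‖ ^ 2 := by
      rw [Real.norm_eq_abs, sq_abs, mul_pow, hσs, one_mul]
    have h2n : ‖(2 : ℝ)⁻¹‖ ^ 2 = 4⁻¹ := by norm_num
    have hsq : ‖(2 : ℝ)⁻¹ • (V + (σs * ‖V‖) • p)‖ ^ 2 = (‖V‖ / Real.sqrt 2) ^ 2 := by
      rw [norm_smul, mul_pow, norm_add_sq_real, inner_smul_right, hVp, mul_zero, norm_smul,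
        mul_pow, hp1, hσn, h2n, div_pow, hs2]
      ring
    exact (sq_eq_sq₀ (norm_nonneg _) (by positivity)).1 hsq
  refine ⟨(2 : ℝ)⁻¹ • (V + (1 * ‖V‖) • p), (2 : ℝ)⁻¹ • (V + ((-1) * ‖V‖) • p), ?_, ?_,
    hn 1 (by norm_num), hn (-1) (by norm_num)⟩
  · rw [← smul_add]
    have : V + (1 * ‖V‖) • p + (V + (-1 * ‖V‖) • p) = (2 : ℝ) • V := by
      rw [two_smul]; module
    rw [this, smul_smul]; norm_num
  · rw [inner_smul_left, inner_smul_right, inner_add_left, inner_add_right, inner_add_right,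
      inner_smul_right, inner_smul_left, inner_smul_left, inner_smul_right, hVV, hVp, hpV, hpp]
    simp
    ring

/-- **Kinematic focusing trees.** For every `k` and every target velocity `V` there are `2^k`
velocities, all of speed `|V| / 2^{k/2}`, from which a sequence of elastic pair collisions (each
with a suitable impact direction) produces ONE sphere with velocity `V` and `2^k - 1` spheres at
rest.  (Velocities only: whether positions on `𝕋³` can realise the schedule without interference,
and with what Liouville weight, is exactly what the crux is about.) -/
theorem focusing_tree (k : ℕ) : ∀ V : V3, ∃ s : Multiset V3, Multiset.card s = 2 ^ k ∧
    (∀ c ∈ s, ‖c‖ = ‖V‖ / Real.sqrt 2 ^ k) ∧ Reach s (V ::ₘ Multiset.replicate (2 ^ k - 1) 0) := by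
  induction k with
  | zero =>
      intro V
      refine ⟨{V}, by simp, fun c hc => ?_, ?_⟩
      · rw [Multiset.mem_singleton.1 hc]; simp
      · simpa using Reach.refl {V}
  | succ k ih =>
      intro V
      obtain ⟨c₁, c₂, hV, hperp, hn1, hn2⟩ := exists_perp_split V
      obtain ⟨s₁, hcard1, hnorm1, hR1⟩ := ih c₁
      obtain ⟨s₂, hcard2, hnorm2, hR2⟩ := ih c₂
      set Z : Multiset V3 := Multiset.replicate (2 ^ k - 1) 0 with hZ
      refine ⟨s₁ + s₂, ?_, ?_, ?_⟩
      · rw [Multiset.card_add, hcard1, hcard2, pow_succ]; ring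
      · intro c hc
        have hsplit : ‖V‖ / Real.sqrt 2 ^ (k + 1) = (‖V‖ / Real.sqrt 2) / Real.sqrt 2 ^ k := by
          rw [pow_succ, div_div, mul_comm]
        rcases Multiset.mem_add.1 hc with h | h
        · rw [hnorm1 c h, hn1, hsplit]
        · rw [hnorm2 c h, hn2, hsplit]
      · have R1 : Reach (s₁ + s₂) ((c₁ ::ₘ Z) + s₂) := hR1.add_right s₂
        have R2 : Reach ((c₁ ::ₘ Z) + s₂) ((c₁ ::ₘ Z) + (c₂ ::ₘ Z)) := hR2.add_left _
        have heq : (c₁ ::ₘ Z) + (c₂ ::ₘ Z) = c₁ ::ₘ c₂ ::ₘ (Z + Z) := by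
          rw [Multiset.cons_add, Multiset.add_cons]
        have R3 : Reach (c₁ ::ₘ c₂ ::ₘ (Z + Z))
            ((reflectVel c₁ (c₁, c₂)).1 ::ₘ (reflectVel c₁ (c₁, c₂)).2 ::ₘ (Z + Z)) :=
          Reach.collide c₁ c₁ c₂ (Z + Z)
        rw [reflectVel_perp' hperp] at R3
        simp only at R3
        have hfin : ((0 : V3) ::ₘ (c₂ + c₁) ::ₘ (Z + Z)) = V ::ₘ Multiset.replicate (2 ^ (k + 1) - 1) 0 := by
          rw [Multiset.cons_swap, add_comm c₂ c₁, ← hV]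
          congr 1
          have h1 : 1 ≤ 2 ^ k := Nat.one_le_two_pow
          have h2 : 2 ^ (k + 1) - 1 = ((2 ^ k - 1) + (2 ^ k - 1)) + 1 := by
            have : 2 ^ (k + 1) = 2 * 2 ^ k := by ring
            omega
          rw [h2, Multiset.replicate_succ, Multiset.replicate_add]
        rw [heq] at R2
        rw [hfin] at R3
        exact (R1.trans R2).trans R3

/-- The natural pathwise strengthening "the cubic tail of a colliding pair does not increase in an
elastic collision" (a maximum principle for the crux functional along every trajectory). -/
def CubicTailNonincreasing : Prop :=
  ∀ (n v w : V3) (M : ℝ),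
    tail3 M (reflectVel n (v, w)).1 + tail3 M (reflectVel n (v, w)).2 ≤ tail3 M v + tail3 M w

/-- **No maximum principle**: with `a = 1`, cut-off `M = 6/5`, both incoming speeds are `1 ≤ M`
(tail `0`) but the outgoing sphere has speed `√2 > 6/5` (tail `2√2 > 0`). Energy focusing by
binary collision trees is kinematically allowed; only its PROBABILITY under the evolved law can
save the crux. -/
theorem cubicTail_not_nonincreasing : ¬ CubicTailNonincreasing := by
  intro h
  have key := h (e 0) (-((1 : ℝ) • e 0)) ((1 : ℝ) • e 1) (6 / 5)
  rw [reflectVel_focus 1] at key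
  have hv : tail3 (6 / 5) (-((1 : ℝ) • e 0)) = 0 :=
    tail3_of_le (by rw [norm_neg, norm_smul, norm_e]; norm_num)
  have hw : tail3 (6 / 5) ((1 : ℝ) • e 1) = 0 :=
    tail3_of_le (by rw [norm_smul, norm_e]; norm_num)
  have h0 : tail3 (6 / 5) (0 : V3) = 0 := tail3_zero _ (by norm_num)
  have hn2 : ‖(1 : ℝ) • e 1 - (1 : ℝ) • e 0‖ ^ 2 = 2 := by rw [norm_sq_focus]; norm_num
  have hgt : (6 / 5 : ℝ) < ‖(1 : ℝ) • e 1 - (1 : ℝ) • e 0‖ := by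
    rw [← abs_of_nonneg (norm_nonneg ((1 : ℝ) • e 1 - (1 : ℝ) • e 0)),
      ← abs_of_nonneg (show (0 : ℝ) ≤ 6 / 5 by norm_num), ← sq_lt_sq, hn2]
    norm_num
  have hw' : tail3 (6 / 5) ((1 : ℝ) • e 1 - (1 : ℝ) • e 0) =
      ‖(1 : ℝ) • e 1 - (1 : ℝ) • e 0‖ ^ 3 := tail3_of_lt hgt
  rw [hv, hw, h0, hw'] at key
  have : (0 : ℝ) < ‖(1 : ℝ) • e 1 - (1 : ℝ) • e 0‖ ^ 3 := by positivity
  linarith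


end EnergyCurrentTailsNegative

end Summit.AtomisticToContinuum.HydrodynamicLimit.Theorems

end
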